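import Summits.NavierStokesRegularity.FluidComputer.PalasekTowerMatchedGermEnergy
import Summits.NavierStokesRegularity.FluidComputer.PalasekTowerHostProfiles

/-!
# The germ host, II: the residual is jointly smooth and vanishes before the start; the FADED FORCE and its box

Cell `ns-blowup`, seat `ns-blowup-ecbridge-3` (g3); GROUP C «BRIDGE SUPPORT» of the route
`PalasekTowerBreakdown` (crux `EpisodeBaseG`, item stmt-NavierStokesRegularity-19179, R2 of record).
LABEL: E–C typing (KERNEL: one definition with body — the faded force — and its calculus). WHAT THIS
IS NOT: not Navier–Stokes evidence — bookkeeping about the NS residual of a PRESCRIBED field; no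
stage, schedule or tower is built here.

## What and why

The germ `germ t = α(t) • U + β(t) • V` of a compactly supported profile `U`
(`PalasekTowerMatchedGerm`, p438782) solves forced Navier–Stokes EXACTLY with force `germResid`
(`isClassicalNSSolutionOn_germ`), a force confined to `tsupport U` (`germResid_eq_zero_of_notMem_tsupport`)
and vanishing at a matched instant (`germResid_eq_zero_of_matched`). To make it the force of a
SCHEDULE (`Schedule.ofBox`: smooth on `ℝ × ℝ³`, compact space-time support, zero from `τ₁` on,
`≤ c₄Y₀` on the first window) this file supplies:

* §1 `contDiff_uncurry_germResid`: the residual is jointly `C^∞` in `(t, x)` (from the expanded form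
  `germResid_eq`: smooth scalars of `t` times smooth fields of `x`);
* §2 `germResid_eq_zero_of_neg`: if `α = β = 0` on `(−∞, 0]` the residual vanishes for `t < 0` (the
  germ is at rest before the start; `deriv α t = deriv β t = 0` there);
* §3 the FADED FORCE `germForce … T w t = fade T w t • germResid t` (`fade = 1` up to `T − w`, `= 0`
  from `T` on, `Host.fade` of p421087): equal to the residual up to `T − w`, zero from `T` on, zero
  off the profile's ball and before the start, jointly smooth, supported in the compact box
  `[0, T] × B̄(0, R)` (`tsupport_germForce_subset`, `hasCompactSupport_germForce`), and bounded by
  `δ` from `τ₀` on whenever the residual is `≤ δ` on `[τ₀, T]` (`norm_germForce_le_of_window`, fed by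
  `exists_window_norm_germResid_le`).

References: C. L. Fefferman, Clay problem description, (5)–(6) (the force class)
[cite: FeffermanClay2006, (5) (6)]; S. Palasek, arXiv:2605.13827 §3.3 (switching the force off inside
the growth window) [cite: Palasek2026ElementaryModel, §3.3].
-/

noncomputable section

namespace Summit.NavierStokesRegularity.FluidComputer.PalasekTowerClayBridge.Germ

open Set Function Filter Topology InnerProductSpace Metric
open scoped Topology ContDiff Laplacian RealInnerProductSpace

open Literature.Analysis.FluidPDE

variable {ν : ℝ} {U : EuclideanSpace ℝ (Fin 3) → EuclideanSpace ℝ (Fin 3)} {α β : ℝ → ℝ}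

/-! ## §1 The residual is jointly smooth -/

section Smooth

variable (hU : ContDiff ℝ ∞ U) (hUc : HasCompactSupport U) (hα : ContDiff ℝ ∞ α) (hβ : ContDiff ℝ ∞ β)
include hU hUc hα hβ

/-- **The germ's residual is jointly `C^∞` in `(t, x)`** (every term of `germResid_eq` is a smooth
scalar of `t` times a smooth field of `x`: `U`, `V`, `(U·∇)U`, `DU·V + DV·U`, `(V·∇)V`, `ΔU`, `ΔV`,
`∇π`, `∇(|∇π|²/2)`). [folklore] -/
theorem contDiff_uncurry_germResid : ContDiff ℝ ∞ (uncurry (germResid ν U α β)) := by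
  have hV := contDiff_accel hU hUc ν
  have hπ := contDiff_pot hU hUc ν
  have sDU : ContDiff ℝ ∞ (fderiv ℝ U) := (contDiff_infty_iff_fderiv.1 hU).2
  have sDV : ContDiff ℝ ∞ (fderiv ℝ (accel ν U)) := (contDiff_infty_iff_fderiv.1 hV).2
  have sΔU : ContDiff ℝ ∞ fun y => (Δ U) y :=
    contDiff_infty.2 fun n => contDiff_laplacian (n := n) (contDiff_infty.1 hU (n + 2))
  have sΔV : ContDiff ℝ ∞ fun y => (Δ (accel ν U)) y :=
    contDiff_infty.2 fun n => contDiff_laplacian (n := n) (contDiff_infty.1 hV (n + 2))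
  have sG : ContDiff ℝ ∞ (gradient (pot ν U)) := contDiff_gradient_of_contDiff_top hπ
  have sN : ContDiff ℝ ∞ (gradient fun y => 2⁻¹ * ‖gradient (pot ν U) y‖ ^ 2) :=
    contDiff_gradient_of_contDiff_top (contDiff_const.mul (sG.norm_sq ℝ))
  have sα' : ContDiff ℝ ∞ (deriv α) := (contDiff_infty_iff_deriv.1 hα).2
  have sβ' : ContDiff ℝ ∞ (deriv β) := (contDiff_infty_iff_deriv.1 hβ).2
  have e : uncurry (germResid ν U α β) = fun q : ℝ × EuclideanSpace ℝ (Fin 3) =>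
      deriv α q.1 • U q.2 + deriv β q.1 • accel ν U q.2 +
        (α q.1 ^ 2 • convect U U q.2 +
          (α q.1 * β q.1) • (fderiv ℝ U q.2 (accel ν U q.2) + fderiv ℝ (accel ν U) q.2 (U q.2)) +
          β q.1 ^ 2 • convect (accel ν U) (accel ν U) q.2) -
        ν • (α q.1 • (Δ U) q.2 + β q.1 • (Δ (accel ν U)) q.2) +
        (deriv β q.1 • gradient (pot ν U) q.2 -
          β q.1 ^ 2 • gradient (fun y => 2⁻¹ * ‖gradient (pot ν U) y‖ ^ 2) q.2) := by
    funext q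
    exact germResid_eq hU hUc q.1 q.2
  rw [e]
  have c1 : ContDiff ℝ ∞ (Prod.fst : ℝ × EuclideanSpace ℝ (Fin 3) → ℝ) := contDiff_fst
  have c2 : ContDiff ℝ ∞ (Prod.snd : ℝ × EuclideanSpace ℝ (Fin 3) → EuclideanSpace ℝ (Fin 3)) :=
    contDiff_snd
  have sconvU : ContDiff ℝ ∞ fun y => convect U U y := contDiff_convect_self hU
  have sconvV : ContDiff ℝ ∞ fun y => convect (accel ν U) (accel ν U) y := contDiff_convect_self hV
  have sX1 : ContDiff ℝ ∞ fun y => fderiv ℝ U y (accel ν U y) := sDU.clm_apply hV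
  have sX2 : ContDiff ℝ ∞ fun y => fderiv ℝ (accel ν U) y (U y) := sDV.clm_apply hU
  refine ((((sα'.comp c1).smul (hU.comp c2)).add ((sβ'.comp c1).smul (hV.comp c2))).add
    ((((((hα.comp c1).pow 2).smul (sconvU.comp c2)).add
      (((hα.comp c1).mul (hβ.comp c1)).smul ((sX1.comp c2).add (sX2.comp c2)))).add
      (((hβ.comp c1).pow 2).smul (sconvV.comp c2))))).sub
    ((((hα.comp c1).smul (sΔU.comp c2)).add
      ((hβ.comp c1).smul (sΔV.comp c2))).const_smul ν) |>.add
    (((sβ'.comp c1).smul (sG.comp c2)).sub (((hβ.comp c1).pow 2).smul (sN.comp c2)))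

end Smooth

/-! ## §2 The residual vanishes before the start -/

section Rest

variable (hU : ContDiff ℝ ∞ U) (hUc : HasCompactSupport U)
  (hα0 : ∀ t, t ≤ 0 → α t = 0) (hβ0 : ∀ t, t ≤ 0 → β t = 0)
include hα0 in
/-- A coefficient vanishing on `(−∞, 0]` has zero derivative before `0`. [folklore] -/
theorem deriv_eq_zero_of_neg_of_vanishing {t : ℝ} (ht : t < 0) : deriv α t = 0 := by
  have hev : α =ᶠ[𝓝 t] fun _ => (0 : ℝ) := by
    filter_upwards [gt_mem_nhds ht] with s hs
    exact hα0 s hs.le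
  rw [hev.deriv_eq, deriv_const]

include hU hUc hα0 hβ0 in
/-- **Before the start the residual vanishes**: if `α = β = 0` on `(−∞, 0]` then `germResid t ≡ 0`
for `t < 0` (all coefficients `α, β, α', β'` vanish there). [folklore] -/
theorem germResid_eq_zero_of_neg {t : ℝ} (ht : t < 0) (x : EuclideanSpace ℝ (Fin 3)) :
    germResid ν U α β t x = 0 := by
  have h1 : α t = 0 := hα0 t ht.le
  have h2 : β t = 0 := hβ0 t ht.le
  have h3 : deriv α t = 0 := deriv_eq_zero_of_neg_of_vanishing hα0 ht
  have h4 : deriv β t = 0 := deriv_eq_zero_of_neg_of_vanishing hβ0 ht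
  rw [germResid_eq hU hUc, h1, h2, h3, h4]
  simp

end Rest

/-! ## §3 The faded force -/

/-- **The faded force of the germ**: `germForce … T w t = fade T w t • germResid t` — the residual
up to `T − w`, switched off smoothly on `[T − w, T]`, zero from `T` on. [cite: Palasek2026ElementaryModel, §3.3] -/
def germForce (ν : ℝ) (U : EuclideanSpace ℝ (Fin 3) → EuclideanSpace ℝ (Fin 3)) (α β : ℝ → ℝ)
    (T w : ℝ) (t : ℝ) (x : EuclideanSpace ℝ (Fin 3)) : EuclideanSpace ℝ (Fin 3) :=
  Host.fade T w t • germResid ν U α β t x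

section Force

variable {T w : ℝ}

/-- Up to `T − w` the faded force IS the residual (`w > 0`). [folklore] -/
theorem germForce_eq_germResid (hw : 0 < w) {t : ℝ} (ht : t ≤ T - w) (x : EuclideanSpace ℝ (Fin 3)) :
    germForce ν U α β T w t x = germResid ν U α β t x := by
  rw [germForce, Host.fade_of_le hw ht, one_smul]

/-- From `T` on the faded force vanishes (`w > 0`). [folklore] -/
theorem germForce_eq_zero_of_ge (hw : 0 < w) {t : ℝ} (ht : T ≤ t) (x : EuclideanSpace ℝ (Fin 3)) :
    germForce ν U α β T w t x = 0 := by
  rw [germForce, Host.fade_of_ge hw ht, zero_smul]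

/-- `‖germForce‖ ≤ ‖germResid‖` (`0 ≤ fade ≤ 1`). [folklore] -/
theorem norm_germForce_le (t : ℝ) (x : EuclideanSpace ℝ (Fin 3)) :
    ‖germForce ν U α β T w t x‖ ≤ ‖germResid ν U α β t x‖ := by
  rw [germForce, norm_smul, Real.norm_eq_abs]
  exact mul_le_of_le_one_left (norm_nonneg _) (Host.abs_fade_le_one t)

variable (hU : ContDiff ℝ ∞ U) (hUc : HasCompactSupport U)

include hU hUc in
/-- **Confinement**: off the profile's ball the faded force vanishes at every time. [folklore] -/
theorem germForce_eq_zero_of_norm_gt {R : ℝ} (hR : tsupport U ⊆ closedBall 0 R) (t : ℝ)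
    {x : EuclideanSpace ℝ (Fin 3)} (hx : R < ‖x‖) : germForce ν U α β T w t x = 0 := by
  rw [germForce, germResid_eq_zero_of_norm_gt hU hUc hR t hx, smul_zero]

include hU hUc in
/-- Before the start the faded force vanishes (`α = β = 0` on `(−∞, 0]`). [folklore] -/
theorem germForce_eq_zero_of_neg (hα0 : ∀ t, t ≤ 0 → α t = 0) (hβ0 : ∀ t, t ≤ 0 → β t = 0) {t : ℝ}
    (ht : t < 0) (x : EuclideanSpace ℝ (Fin 3)) : germForce ν U α β T w t x = 0 := by
  rw [germForce, germResid_eq_zero_of_neg hU hUc hα0 hβ0 ht x, smul_zero]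

include hU hUc in
/-- **The faded force is jointly smooth on `ℝ × ℝ³`.** [cite: FeffermanClay2006, (6)] -/
theorem contDiff_uncurry_germForce (hα : ContDiff ℝ ∞ α) (hβ : ContDiff ℝ ∞ β) :
    ContDiff ℝ ∞ (uncurry (germForce ν U α β T w)) :=
  ((Host.contDiff_fade T w).comp contDiff_fst).smul (contDiff_uncurry_germResid hU hUc hα hβ)

include hU hUc in
/-- **The box**: the faded force is supported in `[0, T] × B̄(0, R)` (`w > 0`, profile in
`B̄(0, R)`, germ at rest before `0`). [cite: FeffermanClay2006, (5)] -/
theorem tsupport_germForce_subset (hw : 0 < w) {R : ℝ} (hR : tsupport U ⊆ closedBall 0 R)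
    (hα0 : ∀ t, t ≤ 0 → α t = 0) (hβ0 : ∀ t, t ≤ 0 → β t = 0) :
    tsupport (uncurry (germForce ν U α β T w)) ⊆
      Icc 0 T ×ˢ closedBall (0 : EuclideanSpace ℝ (Fin 3)) R := by
  refine closure_minimal (fun z hz => ?_) (isClosed_Icc.prod isClosed_closedBall)
  rw [mem_support] at hz
  refine mk_mem_prod ⟨?_, ?_⟩ ?_
  · by_contra h
    exact hz (germForce_eq_zero_of_neg hU hUc hα0 hβ0 (not_le.1 h) z.2)
  · by_contra h
    exact hz (germForce_eq_zero_of_ge hw (le_of_lt (not_le.1 h)) z.2)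
  · rw [mem_closedBall, dist_zero_right]
    by_contra h
    exact hz (germForce_eq_zero_of_norm_gt hU hUc hR z.1 (not_le.1 h))

include hU hUc in
/-- Hence the faded force has compact space-time support. [cite: FeffermanClay2006, (5)] -/
theorem hasCompactSupport_germForce (hw : 0 < w) {R : ℝ} (hR : tsupport U ⊆ closedBall 0 R)
    (hα0 : ∀ t, t ≤ 0 → α t = 0) (hβ0 : ∀ t, t ≤ 0 → β t = 0) :
    HasCompactSupport (uncurry (germForce ν U α β T w)) :=
  (isCompact_Icc.prod (isCompact_closedBall _ _)).of_isClosed_subset isClosed_closure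
    (tsupport_germForce_subset hU hUc hw hR hα0 hβ0)

/-- **The window bound of the faded force**: if the residual is `≤ δ` on `[τ₀, T] × ℝ³` then the
faded force is `≤ δ` at every time `t ≥ τ₀` (`w > 0`, `δ ≥ 0`; beyond `T` it vanishes). [folklore] -/
theorem norm_germForce_le_of_window (hw : 0 < w) {τ₀ δ : ℝ} (hδ : 0 ≤ δ)
    (hwin : ∀ t ∈ Icc τ₀ T, ∀ x : EuclideanSpace ℝ (Fin 3), ‖germResid ν U α β t x‖ ≤ δ)
    {t : ℝ} (ht : τ₀ ≤ t) (x : EuclideanSpace ℝ (Fin 3)) : ‖germForce ν U α β T w t x‖ ≤ δ := by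
  rcases le_or_gt t T with h | h
  · exact (norm_germForce_le t x).trans (hwin t ⟨ht, h⟩ x)
  · rw [germForce_eq_zero_of_ge hw h.le x, norm_zero]
    exact hδ

end Force

end Summit.NavierStokesRegularity.FluidComputer.PalasekTowerClayBridge.Germ

end
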